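import Literature.MathematicalPhysics.QuantumFieldTheory.Balaban1983to89.B9Thm311FromEq3105Schur
import Literature.MathematicalPhysics.QuantumFieldTheory.Balaban1983to89.B9Thm311PosViaLocalInversesY
import Literature.MathematicalPhysics.QuantumFieldTheory.Balaban1983to89.B9GeoLemma21KLevelV1
import Summits.QuantumFields.YangMills.Theorems.BalabanUVNodesN06SectDUnitsAtPins

/-!
# BalabanUVNodes ∕ N06 ([B9], `Dag.B9_main`) — ROW 17 (`hΔA`: THEOREM 3.11 FOR `Δ_a`) FROM ROW 19's DISPLAYED WALK LETTERS AT node00-def-Y's PINS,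
# BY PRINT'S p. 416 ROAD: (3.105) + the factor smallness (displayed) + «the operators G_□ are positive» (one new LOCAL clause)

Track A of `YM-PLAN.md` (cell `pub-ymgap`, HUMAN RULING D-0062), node **N06** = [Balaban1985BackgroundPropagators] Thms 3.1–3.15; seat
`pub-ymgap-dag-n06-j` (bundle F5, rows 15–17), g21.  A HELPER for the stage-11 certificate editions (`…N06AtOpsYNuOfRecordV6EPairN*`): count-neutral,
`--supports` only; the knit seat (dag-n06-d) decides whether to consume it.

THE PRINT (p. 416, verbatim up to notation).  *«Theorem 3.11. Under the assumptions of the Theorems 3.1–3.10 … the operators Δ′_a, G′, (Q′G′²Q′\*)⁻¹, Δ_a,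
G are positive definite. … it is enough to prove it for G. It is a symmetric and invertible operator … By (3.106) G = G₀(I − R)⁻¹, R is an operator with
small norm. Let us assume that the operator G₀ is positive … This is in contradiction with the inequality ⟨A,(I − R\*)A⟩ = ⟨A,A⟩ − Re⟨A,RA⟩ ≥
(1 − O(M⁻¹))⟨A,A⟩ > 0 holding for M sufficiently large. Thus we have to prove the positivity of G₀. By the definition (3.87) it is enough to prove a
positivity of the operators G_□.»*

WHAT.  The certificate of record displays row 17 WHOLE — `hΔA : ∀ x, M311 ≤ M → ∀ α₀ > 0, M·α₀ ≤ a311 → ∀ U, Reg335 c35Y α₀ U → PosDefTr 1 (deltaAY x.toKIdx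
(parSymY …) (parBY …) (GpY … (parSymY …)) U)` — and, inside row 19's `h36A`, the walk letters `𝔬A x : Ops310 (geo9Y x) (bg9Y … x) (XBK (TrIdx N) x.toKIdx) …`
with `Identities310 (𝔬A x) 1 (H x) U` ((3.105) `eq3105`, its transpose `eq3105T`, `inv`, `invT`), `Factors389 (𝔬A x) 1 (H x) q.θ₀ q.δ₀ U`, the static data
`hstA : StaticOK310 (𝔬A x) …` and the pin `hGcoA : (𝔬A x).G U = GcoK x.toKIdx (trBasis N) (bg9Y … x) (fun U => U) (lettersYOfRecordV4P …).GA U`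
(`= GcoK … (GAY x.toKIdx (parSymY …) (parBY …) (GpY … (parSymY …))) U` by `rfl`, `GAY = Ring.inverse deltaAY`).  THIS FILE derives row 17's literal
body from those displayed letters plus ONE local clause, print's remaining input: «each local propagator letter `(𝔬A x).Gsq U i` is symmetric and
positive semi-definite» (`IsTransposePair (Gsq U i) (Gsq U i) ∧ ∀ v, 0 ≤ v ⬝ᵥ Gsq U i v`) — Cor. 3.6 ∕ [4] for the `G_□(U)`, exactly what the A-side
walk-letter instance will owe at r05's `GACubeY` ∕ def-Y's `GAsqY`:
* §1 ★ `deltaA_eq_S0coK_of_inv` — the UNPINNED letter `Δa` is FORCED: `G·Δa = 1`, `Δa·G = 1` and the pin `G = GcoK … (GAY …) U₁` give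
  `IsUnit (deltaAY … (cfg U₁))` (the model of `Ring.inverse Δ_a` is injective ⇒ `Ring.inverse Δ_a` injective (n06-d `injective_of_coordOpK_const`) ⇒ a unit
  (n06-j `isUnit_of_injective`) ⇒ `Δ_a` a unit) and `Δa = S0coK … U₁` (def-Y's `c⁻¹·coordOpK (Δ_a)`, by def-Y's `GcoK_GAY_mul_S0coK` and uniqueness of the
  two-sided inverse);
* §2 ★ `posDefTr_deltaAY_of_posDefEnd_S0coK` — the converse of n06-d's `posDefEnd_S0coK_of_posDefTr`: positivity of the model `S0coK` in real coordinates gives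
  `PosDefTr 1 (deltaAY …)` (scaling by `c > 0` + n06-d's one-slice encoding `posDefTr_of_posDefEnd_coordOpK_const`); ★ `isTransposePair_S0coK` — `S0coK` is
  self-transpose at every `G`-valued `U`, `G ≤ U(N)` (n06-j g20 `deltaAY_parSymY_isSymmTr` + n06-d `isTransposePair_coordOpK_of_isSymmTr`);
* §3 ★ `len_le_of_levelGap` — the level-gap letter of `B9Thm311FromEq3105Schur` ([4] (2.60) as `L^jη ≤ L·e^{(log L∕(R₀M))·d(y,y′)}·L^{j′}η`) from the family
  schema `B9Ineq349Whole.LevelGap geo R₀`; `len_le_geo9Y` — at the geometry of record BY NAME (n06-i `levelGap_geo9Y_one`);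
* §4 ★★★ `posDefTr_deltaAY_of_row19` (one member, one `U`, the (2.61) data explicit) and ★★★ `row17_of_row19_letters` — ROW 17's BODY for ALL members above
  ONE threshold `M_R` (∃-bound: it absorbs q.M₁, the two (2.61) thresholds of n06-i `rowSum261_geo9Y` at the rates `q.δ₀`, `q.δ₀∕2`, `2·log L∕q.δ₀` and
  print's «M sufficiently large» `N_F·θ₀·(c + L·c′)∕2`), from binders shaped EXACTLY as the edition's `hstA`, the `Identities310` ∕ `Factors389` components of
  `h36A`, `hGcoA` (at `GAY …`, definitionally the edition's right-hand side) and the NEW `hGsqA`.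
KNIT (n06-d's call): `have hΔA := row17_of_row19_letters … hstA (fun x hM α₀ hα ha U hU => (h36A x hM α₀ hα ha U hU).2.2) (fun … => (h36A …).2.1) hGcoA hGsqA`
(after `obtain ⟨M_R, …⟩`), the numerics `a311 M311` re-pointed to `q.a₁ ∕ max q.M₁ M_R`; binder `hΔA` LEAVES, binder `hGsqA` (local, next to `h36A`) ENTERS.
HONEST FRAMING.  Finite-dimensional linear algebra + [4] (2.60)–(2.61) bookkeeping on DISPLAYED hypothesis schemas; Cor. 3.6's positivity of the `G_□(U)` is
NOT proved (it is the new displayed local input), nor are (3.105)'s factor bounds (displayed in row 19); nothing of [B9]'s estimates asserted; COUNT-NEUTRAL;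
N06 NOT discharged; K1 NOT closed.  One finite 𝕋⁴ programme at fixed `ε` — NOT continuum, NOT OS, NOT the mass gap ∕ Clay.  0 `def`, 0 `sorry`.
-/

noncomputable section

namespace Summit.QuantumFields.YangMills.BalabanUVNodes.N06Row17FromRow19Letters

open Literature.MathematicalPhysics.QuantumFieldTheory.Balaban1983to89
open Literature.MathematicalPhysics.QuantumFieldTheory.Balaban1983to89.Node00
open Literature.MathematicalPhysics.QuantumFieldTheory.Balaban1983to89.Node00.OpsYSectDCoords (S0coK cR39_trBasis_pos GcoK_GAY_mul_S0coK)
open Literature.MathematicalPhysics.QuantumFieldTheory.Balaban1983to89.B9CoReadingCoords (XBK GcoK coordOpK)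
open Literature.MathematicalPhysics.QuantumFieldTheory.Balaban1983to89.B9CoReadingCoordsTranspose
  (TrIdx trBasis trBasis_repr_eq_trace isTransposePair_coordOpK_of_isSymmTr)
open Literature.MathematicalPhysics.QuantumFieldTheory.Balaban1983to89.B9Thm39ReadingCoords (cR39)
open Literature.MathematicalPhysics.QuantumFieldTheory.Balaban1983to89.B9Thm312Whole (PosDefEnd)
open Literature.MathematicalPhysics.QuantumFieldTheory.Balaban1983to89.B9Thm311ReadingCoords (isUnit_of_injective trIP PosDefTr IsSymmTr)
open Literature.MathematicalPhysics.QuantumFieldTheory.Balaban1983to89.B9Thm37Glue (IsTransposePair)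
open Literature.MathematicalPhysics.QuantumFieldTheory.Balaban1983to89.B9Thm37GlueTorusCov (isTransposePair_smul)
open Literature.MathematicalPhysics.QuantumFieldTheory.Balaban1983to89.B9Thm310Whole (Ops310 StaticOK310 Factors389 Identities310 Sizes310)
open Literature.MathematicalPhysics.QuantumFieldTheory.Balaban1983to89.B9Thm311FromEq3105Schur (posDefEnd_deltaA_of_identities310)
open Literature.MathematicalPhysics.QuantumFieldTheory.Balaban1983to89.B9Thm311PosViaLocalInversesY (deltaAY_parSymY_isSymmTr)
open Literature.MathematicalPhysics.QuantumFieldTheory.Balaban1983to89.B6KLevelCensusIndexV1 (KIdx)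
open Literature.MathematicalPhysics.QuantumFieldTheory.Balaban1983to89.B9Ineq349Whole (LevelGap RowSum261 DistOK)
open Literature.MathematicalPhysics.QuantumFieldTheory.Balaban1983to89.B9PinMembersKLevelV1 (MemberY geo9Y bg9Y)
open Literature.MathematicalPhysics.QuantumFieldTheory.Balaban1983to89.B9GeoLemma21KLevelV1 (levelGap_geo9Y_one rowSum261_geo9Y distOK_geo9Y)
open Summit.QuantumFields.YangMills.BalabanUVNodes.N06SectDUnitsAtPins (injective_of_coordOpK_const injective_of_smul_injective posDefTr_of_posDefEnd_coordOpK_const)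
open scoped Matrix
open scoped Matrix.Norms.L2Operator

/-! ## §1 The unpinned letter `Δa` is forced by `inv ∕ invT` and the pin of `G` -/

section Forced

variable {N : ℕ} {d ℓ : ℕ} {hd : 1 ≤ d + 1} {hL : Odd (ℓ + 1) ∧ 1 < ℓ + 1} {b₀ b₁ : ℝ}

/-- `TrIdx N` is inhabited for `0 < N`. [folklore] -/
private theorem nonempty_trIdx (hN : 0 < N) : Nonempty (TrIdx N) := ⟨(⟨0, hN⟩, ⟨0, hN⟩, 0)⟩

/-- ★ **THE LETTER `Δa` IS FORCED BY THE DISPLAYED IDENTITIES AND THE PIN OF `G`**: if `G = GcoK … (GAY …) U₁` (the edition's `hGcoA`; `GAY = Ring.inverse Δ_a`),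
`G·Δa = 1` and `Δa·G = 1` (`Identities310.inv ∕ invT`), then `Δ_a(U₁)` IS a unit and `Δa = S0coK … U₁` (def-Y's `c⁻¹·coordOpK (Δ_a)`, rows 20–21's pinned `S0`).
(The model of `Ring.inverse Δ_a` is injective, hence so is `Ring.inverse Δ_a`, hence it is a unit, hence `Δ_a` is; then def-Y's `GcoK_GAY_mul_S0coK` and the
uniqueness of a two-sided inverse.) [cite: Balaban1985BackgroundPropagators, (3.27) p.395 («G(U) = Δ_a(U)⁻¹»), Thm 3.11 p.416 («invertible»)] -/
theorem deltaA_eq_S0coK_of_inv (hN : 0 < N) (i : KIdx d ℓ hd hL b₀ b₁) (B : B9.Backgrounds) (cfg : B.Cfg → CfgY (Matrix (Fin N) (Fin N) ℂ) i)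
    (parS : SiteParY (Matrix (Fin N) (Fin N) ℂ) i) (parB : BondParY (Matrix (Fin N) (Fin N) ℂ) i) (Gp : SiteOpY (Matrix (Fin N) (Fin N) ℂ) i)
    (U₁ : B.Cfg) {G Δa : Module.End ℝ (XBK (TrIdx N) i → ℝ)} (hGpin : G = GcoK i (trBasis N) B cfg (GAY i parS parB Gp) U₁)
    (hinv : G * Δa = 1) (hinvT : Δa * G = 1) :
    IsUnit (deltaAY i parS parB Gp (cfg U₁)) ∧ Δa = S0coK i (trBasis N) B cfg parS parB Gp U₁ := by
  haveI : Nonempty (TrIdx N) := nonempty_trIdx hN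
  have hc : cR39 (trBasis N) ≠ 0 := (cR39_trBasis_pos hN).ne'
  -- `G` is injective (it has the right inverse `Δa` on a finite-dimensional space, hence is bijective)
  have hGsurj : Function.Surjective G := fun v => ⟨Δa v, by rw [← Module.End.mul_apply, hinv, Module.End.one_apply]⟩
  have hGinj : Function.Injective G := LinearMap.injective_iff_surjective.mpr hGsurj
  -- hence `Ring.inverse Δ_a` is injective, hence a unit, hence `Δ_a` is a unit
  have hU : IsUnit (deltaAY i parS parB Gp (cfg U₁)) := by
    rw [hGpin, GcoK] at hGinj
    have h1 := injective_of_coordOpK_const (D := Fin (d + 1)) (trBasis N) _ (injective_of_smul_injective hGinj)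
    have h2 : Function.Injective (GAY i parS parB Gp (cfg U₁)) := fun u v huv =>
      h1 (by simpa only [LinearMap.coe_restrictScalars] using huv)
    have h3 : IsUnit (GAY i parS parB Gp (cfg U₁)) := isUnit_of_injective h2
    exact isUnit_ringInverse.mp h3
  refine ⟨hU, ?_⟩
  -- `G · S0coK = 1` (def-Y), so `Δa = Δa·(G·S0coK) = (Δa·G)·S0coK = S0coK`
  have hGS : G * S0coK i (trBasis N) B cfg parS parB Gp U₁ = 1 := by rw [hGpin]; exact GcoK_GAY_mul_S0coK hc hU
  calc Δa = Δa * (G * S0coK i (trBasis N) B cfg parS parB Gp U₁) := by rw [hGS, mul_one]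
    _ = S0coK i (trBasis N) B cfg parS parB Gp U₁ := by rw [← mul_assoc, hinvT, one_mul]

end Forced

/-! ## §2 The model `S0coK` back to the genuine `Δ_a`: positivity and symmetry -/

section Model

variable {N : ℕ} {d ℓ : ℕ} {hd : 1 ≤ d + 1} {hL : Odd (ℓ + 1) ∧ 1 < ℓ + 1} {b₀ b₁ : ℝ}

/-- ★ **POSITIVITY OF THE MODEL GIVES `PosDefTr 1 (Δ_a)`** (the converse of n06-d's `posDefEnd_S0coK_of_posDefTr`): `S0coK = c⁻¹·coordOpK (Δ_a)` with `c > 0`, and a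
positive coordinate form read on one slice is print's trace form (n06-d `posDefTr_of_posDefEnd_coordOpK_const`). [cite: Balaban1985BackgroundPropagators, Thm 3.11 p.416, (3.26) p.395] -/
theorem posDefTr_deltaAY_of_posDefEnd_S0coK (hN : 0 < N) (i : KIdx d ℓ hd hL b₀ b₁) (B : B9.Backgrounds)
    (cfg : B.Cfg → CfgY (Matrix (Fin N) (Fin N) ℂ) i) (parS : SiteParY (Matrix (Fin N) (Fin N) ℂ) i) (parB : BondParY (Matrix (Fin N) (Fin N) ℂ) i)
    (Gp : SiteOpY (Matrix (Fin N) (Fin N) ℂ) i) (U₁ : B.Cfg) (h : PosDefEnd (S0coK i (trBasis N) B cfg parS parB Gp U₁)) :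
    PosDefTr (fun _ => (1 : ℝ)) (deltaAY i parS parB Gp (cfg U₁)) := by
  have hc : 0 < cR39 (trBasis N) := cR39_trBasis_pos hN
  refine posDefTr_of_posDefEnd_coordOpK_const (D := Fin (d + 1)) hN _ fun f hf => ?_
  have h1 := h f hf
  rw [S0coK, LinearMap.smul_apply, dotProduct_smul, smul_eq_mul] at h1
  exact pos_of_mul_pos_right h1 (inv_nonneg.mpr hc.le) |> fun h2 => by
    rcases (mul_pos_iff.mp h1) with ⟨_, h3⟩ | ⟨h4, _⟩
    · exact h3
    · exact absurd h4 (not_lt.mpr (inv_nonneg.mpr hc.le))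

/-- ★ **THE MODEL `S0coK` IS SELF-TRANSPOSE** at every `G`-valued `U`, `G ≤ U(N)` (print: *«It is a symmetric … operator»*): n06-j's `deltaAY_parSymY_isSymmTr` read
through the orthonormal trace basis (n06-d `isTransposePair_coordOpK_of_isSymmTr`). [cite: Balaban1985BackgroundPropagators, Thm 3.11 p.416, p.393 (scalar products)] -/
theorem isTransposePair_S0coK (i : KIdx d ℓ hd hL b₀ b₁) {G : Subgroup (Matrix (Fin N) (Fin N) ℂ)ˣ}
    (hG : G ≤ B7Prop2Explicit.unitaryUnits (Matrix (Fin N) (Fin N) ℂ)) (B : B9.Backgrounds) (cfg : B.Cfg → CfgY (Matrix (Fin N) (Fin N) ℂ) i)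
    (U₁ : B.Cfg) (hU : ∀ μ z, cfg U₁ μ z ∈ G) :
    IsTransposePair (S0coK i (trBasis N) B cfg (parSymY i) (parBY i) (GpY i (parSymY i)) U₁)
      (S0coK i (trBasis N) B cfg (parSymY i) (parBY i) (GpY i (parSymY i)) U₁) := by
  unfold S0coK
  exact isTransposePair_smul
    (isTransposePair_coordOpK_of_isSymmTr (D := Fin (d + 1)) (trBasis N) (trBasis_repr_eq_trace N) _ (deltaAY_parSymY_isSymmTr i hG hU)) _

end Model

/-! ## §3 The level-gap letter ([4] (2.60)) from `LevelGap`, generically and at the geometry of record -/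

section Geometry

/-- powers of `L ≥ 1` across a level gap: `L^j ≤ L · e^{log L · max(|j − j′| − 1, 0)} · L^{j′}`. [cite: Balaban1984PropagatorsII, Lemma 2.1 (2.60) p.234 (the arithmetic behind it)] -/
theorem pow_le_mul_exp_levelGap {L : ℝ} (hL : 1 ≤ L) (j j' : ℕ) :
    L ^ j ≤ L * Real.exp (Real.log L * max (|(j : ℝ) - (j' : ℝ)| - 1) 0) * L ^ j' := by
  have hL0 : 0 < L := lt_of_lt_of_le one_pos hL
  have hlog : 0 ≤ Real.log L := Real.log_nonneg hL
  have hexp1 : 1 ≤ Real.exp (Real.log L * max (|(j : ℝ) - (j' : ℝ)| - 1) 0) :=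
    Real.one_le_exp (mul_nonneg hlog (le_max_right _ _))
  rcases le_or_gt j j' with hjj | hjj
  · -- `j ≤ j′`: `L^j ≤ L^{j′} ≤ L·e^{…}·L^{j′}`
    have h1 : L ^ j ≤ L ^ j' := pow_le_pow_right₀ hL hjj
    have h2 : L ^ j' ≤ L * Real.exp (Real.log L * max (|(j : ℝ) - (j' : ℝ)| - 1) 0) * L ^ j' := by
      have h3 : (1 : ℝ) ≤ L * Real.exp (Real.log L * max (|(j : ℝ) - (j' : ℝ)| - 1) 0) := by nlinarith
      calc L ^ j' = 1 * L ^ j' := (one_mul _).symm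
        _ ≤ _ := mul_le_mul_of_nonneg_right h3 (pow_nonneg hL0.le _)
    exact h1.trans h2
  · -- `j′ < j`: `L^j = L^{j′}·L·L^{j−j′−1}` and `L^{j−j′−1} = e^{(j−j′−1)·log L}`, `j − j′ − 1 = max(|j−j′|−1, 0)`
    obtain ⟨k, hk⟩ : ∃ k, j = j' + (k + 1) := ⟨j - j' - 1, by omega⟩
    have hmax : max (|(j : ℝ) - (j' : ℝ)| - 1) 0 = (k : ℝ) := by
      rw [hk]
      push_cast
      rw [show (j' : ℝ) + ((k : ℝ) + 1) - (j' : ℝ) = (k : ℝ) + 1 by ring, abs_of_nonneg (by positivity), add_sub_cancel_right,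
        max_eq_left (Nat.cast_nonneg k)]
    have hpow : L ^ k = Real.exp (Real.log L * (k : ℝ)) := by
      rw [mul_comm, Real.exp_nat_mul, Real.exp_log hL0]
    rw [hmax, ← hpow, hk, pow_add, pow_succ]
    ring_nf
    exact le_rfl

variable {I : Type} {geo : I → B9.Geometry}

/-- ★ **THE LEVEL-GAP LETTER FROM `LevelGap geo R₀`** ([4] (2.60) read as a comparison of scales): for a member with `L ≥ 1`, `η ≥ 0`, `M > 0`,
`L^jη ≤ L·e^{(log L∕(R₀M))·d(y,y′)}·L^{j′}η` — the hypothesis `hlen` of `B9Thm311FromEq3105Schur.posDefEnd_deltaA_of_identities310` with `Λ = L`, `β = log L∕(R₀M)`.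
[cite: Balaban1984PropagatorsII, Lemma 2.1 (2.60) p.234, (2.2) p.224] -/
theorem len_le_of_levelGap {R₀ : ℝ} (hR₀ : 0 < R₀) (hgap : LevelGap geo R₀) (i : I) (hL : 1 ≤ (geo i).L) (hη : 0 ≤ (geo i).eta)
    (hM : 0 < (geo i).M) (y y' : (geo i).Site) :
    (geo i).len y ≤ (geo i).L * Real.exp (Real.log (geo i).L / (R₀ * (geo i).M) * (geo i).dist y y') * (geo i).len y' := by
  have hlog : 0 ≤ Real.log (geo i).L := Real.log_nonneg hL
  have hRM : 0 < R₀ * (geo i).M := mul_pos hR₀ hM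
  -- the gap: `max(|j − j′| − 1, 0) ≤ d(y,y′)∕(R₀M)`
  have hg : max (|((geo i).scale y : ℝ) - ((geo i).scale y' : ℝ)| - 1) 0 ≤ (geo i).dist y y' / (R₀ * (geo i).M) := by
    rw [le_div_iff₀ hRM]
    have h := hgap i y y'
    nlinarith
  have hexp : Real.exp (Real.log (geo i).L * max (|((geo i).scale y : ℝ) - ((geo i).scale y' : ℝ)| - 1) 0) ≤
      Real.exp (Real.log (geo i).L / (R₀ * (geo i).M) * (geo i).dist y y') := by
    rw [Real.exp_le_exp]
    calc Real.log (geo i).L * max (|((geo i).scale y : ℝ) - ((geo i).scale y' : ℝ)| - 1) 0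
        ≤ Real.log (geo i).L * ((geo i).dist y y' / (R₀ * (geo i).M)) := mul_le_mul_of_nonneg_left hg hlog
      _ = Real.log (geo i).L / (R₀ * (geo i).M) * (geo i).dist y y' := by ring
  have hL0 : 0 < (geo i).L := lt_of_lt_of_le one_pos hL
  have h1 := pow_le_mul_exp_levelGap hL ((geo i).scale y) ((geo i).scale y')
  unfold B9.Geometry.len
  calc (geo i).L ^ (geo i).scale y * (geo i).eta
      ≤ (geo i).L * Real.exp (Real.log (geo i).L * max (|((geo i).scale y : ℝ) - ((geo i).scale y' : ℝ)| - 1) 0) *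
          (geo i).L ^ (geo i).scale y' * (geo i).eta := mul_le_mul_of_nonneg_right h1 hη
    _ ≤ (geo i).L * Real.exp (Real.log (geo i).L / (R₀ * (geo i).M) * (geo i).dist y y') * (geo i).L ^ (geo i).scale y' * (geo i).eta := by
        gcongr
    _ = (geo i).L * Real.exp (Real.log (geo i).L / (R₀ * (geo i).M) * (geo i).dist y y') * ((geo i).L ^ (geo i).scale y' * (geo i).eta) := by
        ring

variable {d ℓ : ℕ} {hd : 1 ≤ d + 1} {hL : Odd (ℓ + 1) ∧ 1 < ℓ + 1} {b₀ b₁ : ℝ} {Mstar : ℕ}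

/-- the level-gap letter AT THE GEOMETRY OF RECORD, BY NAME (n06-i `levelGap_geo9Y_one`, `distOK_geo9Y`): `Λ = L`, `β = log L∕M`.
[cite: Balaban1984PropagatorsII, Lemma 2.1 (2.60) p.234, (2.2) p.224] -/
theorem len_le_geo9Y (x : MemberY d ℓ hd hL b₀ b₁ Mstar) (hM : 0 < (geo9Y x).M) (y y' : (geo9Y x).Site) :
    (geo9Y x).len y ≤ (geo9Y x).L * Real.exp (Real.log (geo9Y x).L / (geo9Y x).M * (geo9Y x).dist y y') * (geo9Y x).len y' := by
  have h := len_le_of_levelGap one_pos levelGap_geo9Y_one x (distOK_geo9Y x).one_le_L (distOK_geo9Y x).eta_pos.le hM y y'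
  rwa [one_mul] at h

end Geometry

/-! ## §4 ★★★ Row 17 from row 19's letters -/

section Row17

variable {N : ℕ} {d ℓ : ℕ} {hd : 1 ≤ d + 1} {hL : Odd (ℓ + 1) ∧ 1 < ℓ + 1} {b₀ b₁ : ℝ} {Mstar : ℕ}
variable {G : Subgroup (Matrix (Fin N) (Fin N) ℂ)ˣ}

/-- ★★★ **ROW 17's BODY AT ONE MEMBER AND ONE `U` FROM ROW 19's LETTERS, THE (2.61) DATA EXPLICIT**: for `G ≤ U(N)`, `N ≥ 1`, a `G`-valued `U`, walk letters
`𝔬 : Ops310 (geo9Y x) B (XBK (TrIdx N) x.toKIdx) Y ι A` over ANY backgrounds record `B` with `cfg : B.Cfg → CfgY`, with the static data (`StaticOK310`), the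
structure at `U` (`Identities310`: `eq3105 ∕ eq3105T ∕ inv ∕ invT`), the factor majorants (`Factors389 … θ₀ δ₀ U`), the pin of `G` to def-Y's `GAY`, the local
clause on the `Gsq U i`, the (2.61) row sums at the rates `δ₀` (`≤ c`) and `δ₀∕2` (`≤ c′`), `M > 0`, `M ≥ 2·log L∕δ₀` and `N_F·θ₀·(c + L·c′) < 2M`:
`PosDefTr 1 (deltaAY x.toKIdx (parSymY …) (parBY …) (GpY … (parSymY …)) (cfg U))`. [cite: Balaban1985BackgroundPropagators, Thm 3.11 p.416 + (3.105) p.414 + (3.87), (3.89) p.409; Balaban1984PropagatorsII, Lemma 2.1 (2.60)–(2.61) p.234] -/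
theorem posDefTr_deltaAY_of_row19 (hN : 0 < N) (hG : G ≤ B7Prop2Explicit.unitaryUnits (Matrix (Fin N) (Fin N) ℂ))
    (x : MemberY d ℓ hd hL b₀ b₁ Mstar) [Fintype (geo9Y x).Site] [DecidableEq (geo9Y x).Site] {B : B9.Backgrounds} (cfg : B.Cfg → CfgY (Matrix (Fin N) (Fin N) ℂ) x.toKIdx)
    {Y ι A : Type} [Fintype ι] [Fintype A] (𝔬 : Ops310 (geo9Y x) B (XBK (TrIdx N) x.toKIdx) Y ι A)
    {Rg : ℝ} {H : Prop} {ρ Nc N' NF Cℓ θ₀ δ₀ c c' : ℝ} {κ : Sizes310} (hθ₀ : 0 ≤ θ₀) (hδ₀ : 0 < δ₀) (hM : 0 < (geo9Y x).M)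
    (hs : StaticOK310 𝔬 ρ Nc N' NF Cℓ κ) (U : B.Cfg) (hU : ∀ μ z, cfg U μ z ∈ G)
    (hI : Identities310 𝔬 Rg H U) (hF : Factors389 𝔬 Rg H θ₀ δ₀ U)
    (hGpin : 𝔬.G U = GcoK x.toKIdx (trBasis N) B cfg (GAY x.toKIdx (parSymY x.toKIdx) (parBY x.toKIdx) (GpY x.toKIdx (parSymY x.toKIdx))) U)
    (hGsq : ∀ i, IsTransposePair (𝔬.Gsq U i) (𝔬.Gsq U i) ∧ ∀ v, 0 ≤ v ⬝ᵥ 𝔬.Gsq U i v)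
    (hrow : ∀ y : (geo9Y x).Site, ∑ y', Real.exp (-(δ₀ * (geo9Y x).dist y y')) ≤ c)
    (hrow' : ∀ y : (geo9Y x).Site, ∑ y', Real.exp (-(δ₀ / 2 * (geo9Y x).dist y y')) ≤ c')
    (hMlog : 2 * Real.log (geo9Y x).L / δ₀ ≤ (geo9Y x).M) (hbig : NF * θ₀ * (c + (geo9Y x).L * c') < 2 * (geo9Y x).M) :
    PosDefTr (fun _ => (1 : ℝ)) (deltaAY x.toKIdx (parSymY x.toKIdx) (parBY x.toKIdx) (GpY x.toKIdx (parSymY x.toKIdx)) (cfg U)) := by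
  classical
  have hL1 : 1 ≤ (geo9Y x).L := (distOK_geo9Y x).one_le_L
  have hL0 : 0 ≤ (geo9Y x).L := zero_le_one.trans hL1
  -- the letter `Δa` is def-Y's model `S0coK`, hence symmetric
  obtain ⟨-, hΔa⟩ := deltaA_eq_S0coK_of_inv hN x.toKIdx B cfg (parSymY x.toKIdx) (parBY x.toKIdx) (GpY x.toKIdx (parSymY x.toKIdx)) U
    hGpin hI.inv hI.invT
  have hΔat : IsTransposePair (𝔬.Δa U) (𝔬.Δa U) := by
    rw [hΔa]; exact isTransposePair_S0coK x.toKIdx hG B cfg U hU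
  -- the level-gap letter with `Λ = L`, `β = log L ∕ M`, and the row sum at the rate `δ₀ − β ≥ δ₀∕2`
  have hβ : Real.log (geo9Y x).L / (geo9Y x).M ≤ δ₀ / 2 := by
    rw [div_le_iff₀ hM]
    have h1 : 2 * Real.log (geo9Y x).L ≤ (geo9Y x).M * δ₀ := (div_le_iff₀ hδ₀).mp hMlog
    linarith
  have hrow'' : ∀ y : (geo9Y x).Site,
      ∑ y', Real.exp (-((δ₀ - Real.log (geo9Y x).L / (geo9Y x).M) * (geo9Y x).dist y y')) ≤ c' := by
    intro y
    refine (Finset.sum_le_sum fun y' _ => Real.exp_le_exp.mpr ?_).trans (hrow' y)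
    have hd : 0 ≤ (geo9Y x).dist y y' := hs.dnn y y'
    nlinarith
  -- Theorem 3.11 on the letters (file `B9Thm311FromEq3105Schur`), then back to the genuine `Δ_a` through the model
  have hPD := posDefEnd_deltaA_of_identities310 𝔬 U hs hI hF hθ₀ hM hL0 (len_le_geo9Y x hM) hrow hrow'' hbig hΔat
    (fun i => (hGsq i).1) (fun i => (hGsq i).2)
  rw [hΔa] at hPD
  exact posDefTr_deltaAY_of_posDefEnd_S0coK hN x.toKIdx B cfg _ _ _ U hPD

/-- ★★★ **ROW 17 (`hΔA`) FROM ROW 19's DISPLAYED LETTERS, FOR ALL MEMBERS ABOVE ONE THRESHOLD** — print's Theorem 3.11 for `Δ_a` by print's road, the binders shaped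
as the certificate's: a backgrounds family `bg x` read into def-Y's configurations by `cfg x` (at the record: `bg := bg9Y … G`, `cfg := fun x U => U`, and
`hcfgG := fun x c α₀ U hU => hU.1.1` — the (3.35) class of record is `G`-valued by definition), the walk letters `𝔬A x` with their static data `hstA`, the
`Identities310` and `Factors389` components of row 19's `h36A` (regime `M₁`, `a₁`, geometric factor `c35`), the pin `hGcoA` of `(𝔬A x).G` to def-Y's
`GcoK … (GAY …)` (DEFINITIONALLY the edition's right-hand side `GcoK … (lettersYOfRecordV4P …).GA`, `GAv4Y` unfolded), and the NEW local clause `hGsqA` («the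
operators G_□(U) are symmetric and positive», p. 416; positive SEMI-definite suffices).  Output: row 17's LITERAL body for every member with `M ≥ M_R`, every
`α₀ > 0` with `c35·M·α₀ ≤ a₁`, every `U` of the class — `M_R ≥ M₁` absorbs [4] Lemma 2.1 at the geometry of record (n06-i `rowSum261_geo9Y` at the rates `δ₀`,
`δ₀∕2`; `levelGap_geo9Y_one`), `2·log L∕δ₀` and print's «M sufficiently large» `½·N_F·θ₀·(c + L·c′) + 1`.  The symmetry of `Δ_a(U)`, the identification of the
letter `Δa` with def-Y's model, the `L²`-smallness of (3.105)'s `R` and the positivity transfer are THEOREMS (this file and `B9Thm311FromEq3105Schur`).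
[cite: Balaban1985BackgroundPropagators, Thm 3.11 p.416 (statement and proof) + (3.105) p.414 + (3.87), (3.89) p.409 + (3.35) p.396; Balaban1984PropagatorsII, Lemma 2.1 (2.60)–(2.61) p.234] -/
theorem row17_of_row19_letters (hN : 0 < N) (hG : G ≤ B7Prop2Explicit.unitaryUnits (Matrix (Fin N) (Fin N) ℂ))
    [∀ x : MemberY d ℓ hd hL b₀ b₁ Mstar, Fintype (geo9Y x).Site] [∀ x : MemberY d ℓ hd hL b₀ b₁ Mstar, DecidableEq (geo9Y x).Site]
    (bg : MemberY d ℓ hd hL b₀ b₁ Mstar → B9.Backgrounds) (cfg : ∀ x : MemberY d ℓ hd hL b₀ b₁ Mstar, (bg x).Cfg → CfgY (Matrix (Fin N) (Fin N) ℂ) x.toKIdx)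
    {c35 : ℝ} (hcfgG : ∀ (x : MemberY d ℓ hd hL b₀ b₁ Mstar) (c α₀ : ℝ) (U : (bg x).Cfg), (bg x).Reg335 c α₀ U → ∀ μ z, cfg x U μ z ∈ G)
    {Y ι A : MemberY d ℓ hd hL b₀ b₁ Mstar → Type} [∀ x, Fintype (ι x)] [∀ x, Fintype (A x)]
    (𝔬A : ∀ x : MemberY d ℓ hd hL b₀ b₁ Mstar, Ops310 (geo9Y x) (bg x) (XBK (TrIdx N) x.toKIdx) (Y x) (ι x) (A x))
    {Rg : MemberY d ℓ hd hL b₀ b₁ Mstar → ℝ} {H : MemberY d ℓ hd hL b₀ b₁ Mstar → Prop} {ρ Nc N' NF Cℓ θ₀ δ₀ M₁ a₁ : ℝ}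
    {κA : MemberY d ℓ hd hL b₀ b₁ Mstar → Sizes310} (hθ₀ : 0 ≤ θ₀) (hδ₀ : 0 < δ₀)
    (hstA : ∀ x, StaticOK310 (𝔬A x) ρ Nc N' NF Cℓ (κA x))
    (hIdA : ∀ x : MemberY d ℓ hd hL b₀ b₁ Mstar, M₁ ≤ (geo9Y x).M → ∀ α₀ : ℝ, 0 < α₀ → c35 * (geo9Y x).M * α₀ ≤ a₁ →
      ∀ U : (bg x).Cfg, (bg x).Reg335 c35 α₀ U → Identities310 (𝔬A x) (Rg x) (H x) U)
    (hFacA : ∀ x : MemberY d ℓ hd hL b₀ b₁ Mstar, M₁ ≤ (geo9Y x).M → ∀ α₀ : ℝ, 0 < α₀ → c35 * (geo9Y x).M * α₀ ≤ a₁ →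
      ∀ U : (bg x).Cfg, (bg x).Reg335 c35 α₀ U → Factors389 (𝔬A x) (Rg x) (H x) θ₀ δ₀ U)
    (hGcoA : ∀ (x : MemberY d ℓ hd hL b₀ b₁ Mstar) (U : (bg x).Cfg), (𝔬A x).G U =
      GcoK x.toKIdx (trBasis N) (bg x) (cfg x) (GAY x.toKIdx (parSymY x.toKIdx) (parBY x.toKIdx) (GpY x.toKIdx (parSymY x.toKIdx))) U)
    (hGsqA : ∀ x : MemberY d ℓ hd hL b₀ b₁ Mstar, M₁ ≤ (geo9Y x).M → ∀ α₀ : ℝ, 0 < α₀ → c35 * (geo9Y x).M * α₀ ≤ a₁ →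
      ∀ U : (bg x).Cfg, (bg x).Reg335 c35 α₀ U → ∀ i, IsTransposePair ((𝔬A x).Gsq U i) ((𝔬A x).Gsq U i) ∧ ∀ v, 0 ≤ v ⬝ᵥ (𝔬A x).Gsq U i v) :
    ∃ MR : ℝ, M₁ ≤ MR ∧ ∀ x : MemberY d ℓ hd hL b₀ b₁ Mstar, MR ≤ (geo9Y x).M → ∀ α₀ : ℝ, 0 < α₀ → c35 * (geo9Y x).M * α₀ ≤ a₁ →
      ∀ U : (bg x).Cfg, (bg x).Reg335 c35 α₀ U →
        PosDefTr (fun _ => (1 : ℝ)) (deltaAY x.toKIdx (parSymY x.toKIdx) (parBY x.toKIdx) (GpY x.toKIdx (parSymY x.toKIdx)) (cfg x U)) := by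
  classical
  -- [4] (2.61) at the geometry of record at the two rates
  obtain ⟨ML, c, hc⟩ := rowSum261_geo9Y (d := d) (ℓ := ℓ) (hd := hd) (hL := hL) (b₀ := b₀) (b₁ := b₁) (Mstar := Mstar) δ₀ hδ₀
  obtain ⟨ML', c', hc'⟩ := rowSum261_geo9Y (d := d) (ℓ := ℓ) (hd := hd) (hL := hL) (b₀ := b₀) (b₁ := b₁) (Mstar := Mstar) (δ₀ / 2) (half_pos hδ₀)
  set Lr : ℝ := ((ℓ + 1 : ℕ) : ℝ) with hLr
  refine ⟨max M₁ (max 1 (max ML (max ML' (max (2 * Real.log Lr / δ₀) (NF * θ₀ * (c + Lr * c') / 2 + 1))))), le_max_left _ _, ?_⟩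
  intro x hMR α₀ hα₀ ha U hUreg
  have hgeoL : (geo9Y x).L = Lr := B9Ineq347Reading.geo9Y_L x
  have hM₁ : M₁ ≤ (geo9Y x).M := (le_max_left _ _).trans hMR
  have h1 : (1 : ℝ) ≤ (geo9Y x).M := le_trans (by simp only [le_max_iff, le_refl, true_or, or_true]) hMR
  have hML : ML ≤ (geo9Y x).M := le_trans (by simp only [le_max_iff, le_refl, true_or, or_true]) hMR
  have hML' : ML' ≤ (geo9Y x).M := le_trans (by simp only [le_max_iff, le_refl, true_or, or_true]) hMR
  have hMlog : 2 * Real.log Lr / δ₀ ≤ (geo9Y x).M := le_trans (by simp only [le_max_iff, le_refl, true_or, or_true]) hMR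
  have hMbig : NF * θ₀ * (c + Lr * c') / 2 + 1 ≤ (geo9Y x).M := le_trans (by simp only [le_max_iff, le_refl, or_true]) hMR
  have hM : 0 < (geo9Y x).M := lt_of_lt_of_le one_pos h1
  have hbig : NF * θ₀ * (c + (geo9Y x).L * c') < 2 * (geo9Y x).M := by rw [hgeoL]; linarith
  exact posDefTr_deltaAY_of_row19 hN hG x (cfg x) (𝔬A x) hθ₀ hδ₀ hM (hstA x) U (hcfgG x c35 α₀ U hUreg) (hIdA x hM₁ α₀ hα₀ ha U hUreg)
    (hFacA x hM₁ α₀ hα₀ ha U hUreg) (hGcoA x U) (hGsqA x hM₁ α₀ hα₀ ha U hUreg) (hc x hML) (hc' x hML') (by rw [hgeoL]; exact hMlog) hbig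

end Row17

end Summit.QuantumFields.YangMills.BalabanUVNodes.N06Row17FromRow19Letters

end
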